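import Summits.QuantumFields.BalabanUV.Beta.GAN24.GaugeReadExitPairing
import Summits.QuantumFields.BalabanUV.Beta.GAN24.ExitDefectContourSums

/-!
# `BalabanUV.Beta.GAN24.EdgePotentialAxialGauge` — binder row G-an2-4 ∕ (CONV-C), the (S) row of RULING R-gan24p1-g27-1 B (viii), the Ward-type half (W-γ), EXIT class, jb = 0:
# **ENGINE E-leaf06-g46-1 (M1) AS A THEOREM — `Σ'_u Σ_κ ((d*d)m̃_ab) κ u·w^{(γ)}_y(e; κ,u) = −(cE∕2)·Σ'_t Σ_l 1_{B(y)}(t+e_l)·colH G₀(e) l t·((d*d)m̃_ab)_l(t)`, EVERY `a ≠ b`,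
# EVERY slot `e = (ν,y′)`, EVERY label `y`, EVERY in-block root**, via the explicit COMB-FREE representative `m̂_ab = m̃_ab − dz μ` of the edge potential
# (G-an2-4 formalisation swarm → CRUX TEAM (2), seat `b2b-balaban-gan24-formalise-leaf-06` = the (γ) hand, gen 47, INTENT 2 FILE E)

NOT IN PRINT; OUR BOOKKEEPING ([folklore] BY NAME over FILE C `GaugeReadExitPairing.gaugeRead_exitPairing_gaugeWt` (the pairing with its displayed defect), FILE D
`ExitDefectContourSums.contourSum_bondSum_blockInd_eq_zero` (the defect's contour sums vanish), FILE A `CombFreeGaugeLegCharges.axProjAt_eq_self_of_comb_zero`, g46 `EdgePlaquettePotential`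
(`edgePotential_apply`, `dz_resid`, `curvAdj_curv_sub_dz`, `curvAdj_curv_edgePotential`); 0 `def`, 0 cited fact, 0 `def … : Prop`, 0 sorry).  HONEST FRAMING (cell contract, verbatim):
«discharging `BetaPertH` makes Bałaban's UV stability UNCONDITIONAL — a real constructive-QFT result; it is NOT the continuum limit and NOT the Clay problem.»  HONEST DEPENDENCY (verbatim):
«continuum YM on T⁴ ⇐ BetaPertH ∧ nine spine estimates (0/9 proved); BetaPertH ⇐ (D1) ∧ (D4) ∧ CAP+tail; G-an2-4 gates asym, D1 and NE2/3/4.»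
* §1 **`gaugeRead_exitPairing_of_transverse`** — NO DEFECT for every bounded `Lc`-periodic COMB-FREE `m` whose non-exit bonds carry transverse values (`m κ z = g_κ(update z κ 0)` off the
  exit face, every `κ`): FILE C's pairing with FILE D (`Π^ρ m = m`, `𝒬 n_m = 0`).
* §2 THE COMB-FREE EDGE POTENTIAL (`μ(x) := Lc⁻²·t_b(x)·(t_a(x) − r_a)`, `t_c = x_c % Lc`, `m̂_ab := m̃_ab − dz μ`, written out — no `def`): `resid_add_unitVec`,
  **`combFreeEdgePotential_apply`** (`m̂ l x = [l=a]·Lc⁻¹t_b𝟙^{exit}_a − [l=b]·(Lc⁻¹r_a𝟙^{exit}_b + Lc⁻²(t_a − r_a))`), **`combFreeEdgePotential_comb_zero`** (`a < b`: zero on the comb bonds of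
  `toSite r` — a comb bond never exits; on a `b`-comb bond the lower coordinate `a` sits at the root), **`combFreeEdgePotential_transverse`** (direction `a`: `0`; direction `b`: `−Lc⁻²(t_a − r_a)`;
  else `0`), `abs_combFreeEdgePotential_le` (`≤ 2`), `combFreeEdgePotential_add_zsmul` (periodic).
* §3 **`gaugeRead_exitPairing_edgePotential_lt`** (`a < b`: §1 at `m̂_ab`, Maxwell image = that of `m̃_ab`), `curvAdj_neg_apply`, **`curvAdj_curv_edgePotential_swap`** (`(d*d)m̃_ab = −(d*d)m̃_ba`),
  **`gaugeRead_exitPairing_edgePotential`** (EVERY `a ≠ b`).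
READING.  `w^{(γ)}_y(e;κ,u) = Σ'_x Σ_κ₂ (G₀∘𝒟(e)) u x (inl κ)(inl κ₂)·gaugeWt Lc y κ₂ x` is the literal (γ) read weight of `GaugeReadChargeComb` ∕ `GaugeReadChargeProfile` at jb = 0; by leaf-02
g56's `SrecExitChargeLevelZero` (exit⊗exit slot charges of the level-0 table `= −¼cE·(d*d)m_ab`, `(d*d)m̃_ab = ½(d*d)m_ab`) the left side is the exit⊗exit (γ) charge of the slot up to a
displayed scalar; the right side is ENGINE (M1)'s `R(e)` (`g⁺ = ½·1_{B(y)}(·+e)`).  With g46 INTENT 3 `EdgePotentialColumnOrthogonal.edgePotential_orthogonal_colH` ((M2): the `g⁺(e)`-part of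
the (α⁺) read-vector drops out) the remaining step to `C_ab(e) = 0` at jb = 0 is the (α⁺) value form (road-P2's `WardResidualRotatedVertex*`) — not here.  Asserts NO value of any resolvent
column; NOTHING of (W-γ) ∕ (INV) ∕ (S) ∕ (Q-R) ∕ «T2Shape» ∕ (hW, hWall) discharged beyond this identity; NEVER «G-an2-4 closed» as (CONV-C); NOT D1, NOT `BetaPertH`, NOT continuum, NOT
Clay.  2026-08-22; no existing file touched.
-/

noncomputable section

open Finset
open scoped BigOperators
open Literature.MathematicalPhysics.QuantumFieldTheory
open Literature.MathematicalPhysics.QuantumFieldTheory.Balaban1983to89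
open Literature.MathematicalPhysics.QuantumFieldTheory.Balaban1983to89.Beta
open ExpKernelCalculus (Site MKer comp)
open AffineAveraging (Form0 Form1 Form2 box toSite unitVec unitVec_apply dz curv curvAdj contourSum)
open AveragingContours (blk)
open RootedComb (axProjAt)
open OneStepResolventKernel (Fib)
open OneStepKernelFamily (KInvStep colH)
open SecondOrderResponse (colM dM)
open BalabanStepW2 (wM1)
open Summit.QuantumFields.BalabanUV.Beta.AxialDressingRooted (IsCombBondAt coDressKBmAt one_le_of_neZero)
open Summit.QuantumFields.BalabanUV.Beta.SpineRooted (SpureRecAt M1At)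
open Summit.QuantumFields.BalabanUV.Beta.KernelWardRelative (gaugeWt)
open Summit.QuantumFields.BalabanUV.Beta.GAN24.EdgePlaquettePotential (dz_resid emod_add_unitVec_of_ne edgePotential_apply cast_emod_nonneg_le curvAdj_curv_sub_dz
  curvAdj_curv_edgePotential)
open Summit.QuantumFields.BalabanUV.Beta.GAN24.CombFreeGaugeLegCharges (axProjAt_eq_self_of_comb_zero)
open Summit.QuantumFields.BalabanUV.Beta.GAN24.GaugeReadExitPairing (gaugeRead_exitPairing_gaugeWt contourSum_sourceForm_eq_zero not_isCombBondAt_of_exit)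
open Summit.QuantumFields.BalabanUV.Beta.GAN24.ExitDefectContourSums (contourSum_bondSum_blockInd_eq_zero)

namespace Summit.QuantumFields.BalabanUV.Beta.GAN24.EdgePotentialAxialGauge

variable {d : ℕ}

/-! ## §1 No defect for comb-free periodic forms whose non-exit bonds carry transverse values -/

/-- NOT IN PRINT; OUR BOOKKEEPING.  **THE (γ) EXIT PAIRING WITHOUT DEFECT**: for a bounded `Lc`-periodic COMB-FREE 1-form `m` (in-block root `ρ = toSite r`) whose NON-EXIT bonds in
every direction `κ` carry a value depending only on the transverse coordinates (`m κ z = g_κ (update z κ 0)` when `z_κ % Lc ≠ Lc − 1`), and every label `y`: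
`Σ'_u Σ_κ (d*d m) κ u·(Σ'_x Σ_κ₂ (G₀∘𝒟(e)) u x (inl κ)(inl κ₂)·gaugeWt Lc y κ₂ x) = −(cE∕2)·Σ'_t Σ_l 1_{B(y)}(t + e_l)·colH G₀ Lc ν y′ l t·(d*d m)_l(t)` —
`GaugeReadExitPairing.gaugeRead_exitPairing_gaugeWt` with its defect killed by `ExitDefectContourSums.contourSum_bondSum_blockInd_eq_zero` (`Π^ρ m = m`, `𝒬 n_m = 0`). -/
theorem gaugeRead_exitPairing_of_transverse {Lc : ℕ} [NeZero Lc] {r : Fin (d + 1) → ℕ} (hr : r ∈ box (d + 1) Lc) (cE cVH cΛ : ℝ) (ν : Fin (d + 1)) (y' y : Site (d + 1))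
    {m : Form1 (d + 1) ℝ} {B : ℝ} (hmB : ∀ κ u, |m κ u| ≤ B) (hper : ∀ κ x v, m κ (x + (Lc : ℤ) • v) = m κ x)
    (hm0 : ∀ κ u, IsCombBondAt (toSite r) Lc κ u → m κ u = 0)
    (hT : ∀ κ : Fin (d + 1), ∃ g : Site (d + 1) → ℝ, ∀ z : Site (d + 1), z κ % (Lc : ℤ) ≠ (Lc : ℤ) - 1 → m κ z = g (Function.update z κ 0)) :
    ∑' u, ∑ κ, curvAdj (curv m) κ u * (∑' x, ∑ κ₂,
        comp (coDressKBmAt (toSite r) Lc (KInvStep (d := d) Lc 0))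
          (dM (coDressKBmAt (toSite r) Lc (KInvStep (d := d) Lc 0)) Lc (SpureRecAt d Lc (toSite r) cE cVH cΛ 0) (M1At d Lc (toSite r) cΛ 0) ν y')
          u x (Sum.inl κ) (Sum.inl κ₂) * gaugeWt Lc y κ₂ x)
      = -(cE / 2) * (∑' t, ∑ l, (if blk Lc (t + unitVec l) = y then (1 : ℝ) else 0)
            * colH (coDressKBmAt (toSite r) Lc (KInvStep (d := d) Lc 0)) Lc ν y' l t * curvAdj (curv m) l t) := by
  have hLc : 1 ≤ Lc := one_le_of_neZero Lc
  rw [gaugeRead_exitPairing_gaugeWt hr cE cVH cΛ ν y' y hmB hper]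
  have hPi : axProjAt (toSite r) Lc m = m := axProjAt_eq_self_of_comb_zero hLc hr hm0
  have hzero : ∀ (w : Site (d + 1)) (κ : Fin (d + 1)), contourSum Lc (fun κ u => ((if blk Lc u = y then (1 : ℝ) else 0) + (if blk Lc (u + unitVec κ) = y then (1 : ℝ) else 0))
      * (axProjAt (toSite r) Lc m κ u - ((Lc : ℝ) ^ (d + 1))⁻¹ * (contourSum Lc m κ 0 * (if u κ % (Lc : ℤ) = (Lc : ℤ) - 1 then (1 : ℝ) else 0)))) κ w = 0 := by
    intro w κ
    obtain ⟨g, hg⟩ := hT κ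
    refine contourSum_bondSum_blockInd_eq_zero hLc κ w y (g := g) (fun z hz => ?_) (contourSum_sourceForm_eq_zero r hper κ w)
    show axProjAt (toSite r) Lc m κ z - ((Lc : ℝ) ^ (d + 1))⁻¹ * (contourSum Lc m κ 0 * (if z κ % (Lc : ℤ) = (Lc : ℤ) - 1 then (1 : ℝ) else 0)) = g (Function.update z κ 0)
    rw [hPi, if_neg hz, mul_zero, mul_zero, sub_zero, hg z hz]
  simp only [hzero, zero_mul, Finset.sum_const_zero, tsum_zero, mul_zero, add_zero]

/-! ## §2 The comb-free representative of the edge potential (`a < b`, in-block root `r`) -/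

/-- [folklore] The residue coordinate steps by `1 − Lc·𝟙^{exit}` along its own direction and not at all along the others (`dz_resid` read as a difference). -/
theorem resid_add_unitVec {Lc : ℕ} (hLc : 1 ≤ Lc) (c l : Fin (d + 1)) (x : Site (d + 1)) :
    ((((x + unitVec l) c % (Lc : ℤ) : ℤ)) : ℝ) = (((x c % (Lc : ℤ) : ℤ)) : ℝ)
      + (if l = c then 1 - (Lc : ℝ) * (if x c % (Lc : ℤ) = (Lc : ℤ) - 1 then (1 : ℝ) else 0) else 0) := by
  have h := dz_resid hLc c l x
  simp only [AffineAveraging.dz] at h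
  linarith

/-- NOT IN PRINT; OUR BOOKKEEPING.  **THE COMB-FREE EDGE POTENTIAL IN CLOSED FORM** (`a ≠ b`, `1 ≤ Lc`): with `μ(x) := Lc⁻²·t_b(x)·(t_a(x) − r_a)` (`t_c = x_c % Lc`),
`m̂_ab := m̃_ab − dz μ` reads `m̂ l x = [l = a]·Lc⁻¹·t_b(x)·𝟙^{exit}_a(x) − [l = b]·(Lc⁻¹·r_a·𝟙^{exit}_b(x) + Lc⁻²·(t_a(x) − r_a))`. -/
theorem combFreeEdgePotential_apply {Lc : ℕ} (hLc : 1 ≤ Lc) (r : Fin (d + 1) → ℕ) {a b : Fin (d + 1)} (hab : a ≠ b) (l : Fin (d + 1)) (x : Site (d + 1)) :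
    (((Lc : ℝ) ^ 2)⁻¹ * ((((x + unitVec l) b % (Lc : ℤ) : ℤ)) : ℝ) * dz (fun z : Site (d + 1) => ((z a : ℤ) : ℝ)) l x
        - (Lc : ℝ)⁻¹ * (((x a % (Lc : ℤ) : ℤ)) : ℝ) * dz (fun z : Site (d + 1) => (((z b / (Lc : ℤ) : ℤ)) : ℝ)) l x)
      - dz (fun z : Site (d + 1) => ((Lc : ℝ) ^ 2)⁻¹ * (((z b % (Lc : ℤ) : ℤ)) : ℝ) * ((((z a % (Lc : ℤ) : ℤ)) : ℝ) - (r a : ℝ))) l x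
      = (if l = a then (Lc : ℝ)⁻¹ * (((x b % (Lc : ℤ) : ℤ)) : ℝ) * (if x a % (Lc : ℤ) = (Lc : ℤ) - 1 then (1 : ℝ) else 0) else 0)
        - (if l = b then (Lc : ℝ)⁻¹ * (r a : ℝ) * (if x b % (Lc : ℤ) = (Lc : ℤ) - 1 then (1 : ℝ) else 0)
            + ((Lc : ℝ) ^ 2)⁻¹ * ((((x a % (Lc : ℤ) : ℤ)) : ℝ) - (r a : ℝ)) else 0) := by
  have hL0 : (Lc : ℝ) ≠ 0 := by exact_mod_cast (show Lc ≠ 0 by omega)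
  rw [edgePotential_apply hLc hab]
  simp only [AffineAveraging.dz]
  rw [resid_add_unitVec hLc b l x, resid_add_unitVec hLc a l x]
  by_cases hla : l = a
  · subst hla
    rw [if_pos rfl, if_pos rfl, if_neg hab, if_neg hab, if_neg hab, if_pos rfl]
    field_simp
    ring
  · rw [if_neg hla, if_neg hla, if_neg hla]
    by_cases hlb : l = b
    · subst hlb
      rw [if_pos rfl, if_pos rfl, if_pos rfl]
      field_simp
      ring
    · rw [if_neg hlb, if_neg hlb, if_neg hlb]
      ring

/-- NOT IN PRINT; OUR BOOKKEEPING.  **`m̂_ab` VANISHES ON THE COMB BONDS** of the root `toSite r` when `a < b` (`r ∈ box`): a comb bond never exits its block, and on a comb bond of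
direction `b` the lower coordinate `a` sits at the root, `t_a = r_a`. -/
theorem combFreeEdgePotential_comb_zero {Lc : ℕ} (hLc : 1 ≤ Lc) {r : Fin (d + 1) → ℕ} (hr : r ∈ box (d + 1) Lc) {a b : Fin (d + 1)} (hab : a < b)
    {l : Fin (d + 1)} {x : Site (d + 1)} (h : IsCombBondAt (toSite r) Lc l x) :
    (((Lc : ℝ) ^ 2)⁻¹ * ((((x + unitVec l) b % (Lc : ℤ) : ℤ)) : ℝ) * dz (fun z : Site (d + 1) => ((z a : ℤ) : ℝ)) l x
        - (Lc : ℝ)⁻¹ * (((x a % (Lc : ℤ) : ℤ)) : ℝ) * dz (fun z : Site (d + 1) => (((z b / (Lc : ℤ) : ℤ)) : ℝ)) l x)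
      - dz (fun z : Site (d + 1) => ((Lc : ℝ) ^ 2)⁻¹ * (((z b % (Lc : ℤ) : ℤ)) : ℝ) * ((((z a % (Lc : ℤ) : ℤ)) : ℝ) - (r a : ℝ))) l x = 0 := by
  rw [combFreeEdgePotential_apply hLc r hab.ne l x]
  have hne : ¬ (x l % (Lc : ℤ) = (Lc : ℤ) - 1) := fun hx => not_isCombBondAt_of_exit hLc (toSite r) hx h
  by_cases hla : l = a
  · subst hla
    rw [if_pos rfl, if_neg hne, if_neg hab.ne, mul_zero, sub_zero]
  · rw [if_neg hla, zero_sub, neg_eq_zero]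
    by_cases hlb : l = b
    · subst hlb
      rw [if_pos rfl, if_neg hne, mul_zero, zero_add]
      have hra : r a < Lc := Finset.mem_range.1 (Fintype.mem_piFinset.1 hr a)
      have hxa : x a = ((Lc : ℤ) • blk Lc x) a + toSite r a := h.1 a hab
      have e : x a % (Lc : ℤ) = (r a : ℤ) := by
        rw [hxa]
        simp only [Pi.smul_apply, smul_eq_mul, AffineAveraging.toSite]
        rw [add_comm, Int.add_mul_emod_self_left, Int.emod_eq_of_lt (by positivity) (by exact_mod_cast hra)]
      rw [e]; push_cast; ring
    · rw [if_neg hlb]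

/-- NOT IN PRINT; OUR BOOKKEEPING.  **THE NON-EXIT BONDS OF `m̂_ab` CARRY TRANSVERSE VALUES** (`a ≠ b`): direction `a`: `0`; direction `b`: `−Lc⁻²(t_a − r_a)`; other directions: `0`. -/
theorem combFreeEdgePotential_transverse {Lc : ℕ} (hLc : 1 ≤ Lc) (r : Fin (d + 1) → ℕ) {a b : Fin (d + 1)} (hab : a ≠ b) (κ : Fin (d + 1)) :
    ∃ g : Site (d + 1) → ℝ, ∀ z : Site (d + 1), z κ % (Lc : ℤ) ≠ (Lc : ℤ) - 1 →
      (((Lc : ℝ) ^ 2)⁻¹ * ((((z + unitVec κ) b % (Lc : ℤ) : ℤ)) : ℝ) * dz (fun w : Site (d + 1) => ((w a : ℤ) : ℝ)) κ z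
          - (Lc : ℝ)⁻¹ * (((z a % (Lc : ℤ) : ℤ)) : ℝ) * dz (fun w : Site (d + 1) => (((w b / (Lc : ℤ) : ℤ)) : ℝ)) κ z)
        - dz (fun w : Site (d + 1) => ((Lc : ℝ) ^ 2)⁻¹ * (((w b % (Lc : ℤ) : ℤ)) : ℝ) * ((((w a % (Lc : ℤ) : ℤ)) : ℝ) - (r a : ℝ))) κ z
        = g (Function.update z κ 0) := by
  by_cases hκb : κ = b
  · subst hκb
    refine ⟨fun w => -(((Lc : ℝ) ^ 2)⁻¹ * ((((w a % (Lc : ℤ) : ℤ)) : ℝ) - (r a : ℝ))), fun z hz => ?_⟩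
    rw [combFreeEdgePotential_apply hLc r hab κ z, if_neg (Ne.symm hab), if_pos rfl, if_neg hz]
    show _ = -(((Lc : ℝ) ^ 2)⁻¹ * ((((Function.update z κ 0 a % (Lc : ℤ) : ℤ)) : ℝ) - (r a : ℝ)))
    rw [Function.update_of_ne hab]
    ring
  · refine ⟨fun _ => 0, fun z hz => ?_⟩
    rw [combFreeEdgePotential_apply hLc r hab κ z, if_neg hκb]
    by_cases hκa : κ = a
    · subst hκa; rw [if_pos rfl, if_neg hz]; ring
    · rw [if_neg hκa]; ring
set_option maxHeartbeats 400000 in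
/-- NOT IN PRINT; OUR BOOKKEEPING.  **`m̂_ab` IS BOUNDED BY `2`** (`a ≠ b`, `1 ≤ Lc`, `r ∈ box`). -/
theorem abs_combFreeEdgePotential_le {Lc : ℕ} (hLc : 1 ≤ Lc) {r : Fin (d + 1) → ℕ} (hr : r ∈ box (d + 1) Lc) {a b : Fin (d + 1)} (hab : a ≠ b)
    (l : Fin (d + 1)) (x : Site (d + 1)) :
    |(((Lc : ℝ) ^ 2)⁻¹ * ((((x + unitVec l) b % (Lc : ℤ) : ℤ)) : ℝ) * dz (fun z : Site (d + 1) => ((z a : ℤ) : ℝ)) l x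
        - (Lc : ℝ)⁻¹ * (((x a % (Lc : ℤ) : ℤ)) : ℝ) * dz (fun z : Site (d + 1) => (((z b / (Lc : ℤ) : ℤ)) : ℝ)) l x)
      - dz (fun z : Site (d + 1) => ((Lc : ℝ) ^ 2)⁻¹ * (((z b % (Lc : ℤ) : ℤ)) : ℝ) * ((((z a % (Lc : ℤ) : ℤ)) : ℝ) - (r a : ℝ))) l x| ≤ 2 := by
  rw [combFreeEdgePotential_apply hLc r hab l x]
  have hLpos : (0 : ℝ) < Lc := by exact_mod_cast hLc
  have hL1 : (1 : ℝ) ≤ Lc := by exact_mod_cast hLc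
  obtain ⟨hb0, hb1⟩ := cast_emod_nonneg_le hLc b x
  obtain ⟨ha0, ha1⟩ := cast_emod_nonneg_le hLc a x
  have hra : (r a : ℝ) ≤ (Lc : ℝ) - 1 := by
    have : r a < Lc := Finset.mem_range.1 (Fintype.mem_piFinset.1 hr a)
    have : (r a : ℝ) + 1 ≤ Lc := by exact_mod_cast this
    linarith
  have hr0 : (0 : ℝ) ≤ r a := by positivity
  have q1 : 0 ≤ (Lc : ℝ)⁻¹ * (((x b % (Lc : ℤ) : ℤ)) : ℝ) ∧ (Lc : ℝ)⁻¹ * (((x b % (Lc : ℤ) : ℤ)) : ℝ) ≤ 1 :=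
    ⟨by positivity, by rw [inv_mul_le_iff₀ hLpos]; linarith⟩
  have q2 : 0 ≤ (Lc : ℝ)⁻¹ * (r a : ℝ) ∧ (Lc : ℝ)⁻¹ * (r a : ℝ) ≤ 1 := ⟨by positivity, by rw [inv_mul_le_iff₀ hLpos]; linarith⟩
  have q3 : |((Lc : ℝ) ^ 2)⁻¹ * ((((x a % (Lc : ℤ) : ℤ)) : ℝ) - (r a : ℝ))| ≤ 1 := by
    rw [abs_mul, abs_of_pos (by positivity), inv_mul_le_iff₀ (by positivity), abs_le]
    constructor <;> nlinarith
  rw [abs_le] at q3 ⊢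
  obtain ⟨q3a, q3b⟩ := q3
  constructor <;> split_ifs <;> nlinarith [q1.1, q1.2, q2.1, q2.2]

/-- NOT IN PRINT; OUR BOOKKEEPING.  **`m̂_ab` IS `Lc`-PERIODIC** in every direction. -/
theorem combFreeEdgePotential_add_zsmul {Lc : ℕ} (hLc : 1 ≤ Lc) (r : Fin (d + 1) → ℕ) {a b : Fin (d + 1)} (hab : a ≠ b) (l : Fin (d + 1)) (x v : Site (d + 1)) :
    (((Lc : ℝ) ^ 2)⁻¹ * ((((x + (Lc : ℤ) • v + unitVec l) b % (Lc : ℤ) : ℤ)) : ℝ) * dz (fun z : Site (d + 1) => ((z a : ℤ) : ℝ)) l (x + (Lc : ℤ) • v)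
        - (Lc : ℝ)⁻¹ * ((((x + (Lc : ℤ) • v) a % (Lc : ℤ) : ℤ)) : ℝ) * dz (fun z : Site (d + 1) => (((z b / (Lc : ℤ) : ℤ)) : ℝ)) l (x + (Lc : ℤ) • v))
      - dz (fun z : Site (d + 1) => ((Lc : ℝ) ^ 2)⁻¹ * (((z b % (Lc : ℤ) : ℤ)) : ℝ) * ((((z a % (Lc : ℤ) : ℤ)) : ℝ) - (r a : ℝ))) l (x + (Lc : ℤ) • v)
      = (((Lc : ℝ) ^ 2)⁻¹ * ((((x + unitVec l) b % (Lc : ℤ) : ℤ)) : ℝ) * dz (fun z : Site (d + 1) => ((z a : ℤ) : ℝ)) l x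
        - (Lc : ℝ)⁻¹ * (((x a % (Lc : ℤ) : ℤ)) : ℝ) * dz (fun z : Site (d + 1) => (((z b / (Lc : ℤ) : ℤ)) : ℝ)) l x)
      - dz (fun z : Site (d + 1) => ((Lc : ℝ) ^ 2)⁻¹ * (((z b % (Lc : ℤ) : ℤ)) : ℝ) * ((((z a % (Lc : ℤ) : ℤ)) : ℝ) - (r a : ℝ))) l x := by
  rw [combFreeEdgePotential_apply hLc r hab, combFreeEdgePotential_apply hLc r hab]
  have hc : ∀ c : Fin (d + 1), (x + (Lc : ℤ) • v) c % (Lc : ℤ) = x c % (Lc : ℤ) := fun c => by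
    simp only [Pi.add_apply, Pi.smul_apply, smul_eq_mul]
    exact Int.add_mul_emod_self_left (x c) (Lc : ℤ) (v c)
  rw [hc a, hc b]

/-! ## §3 The (γ) exit pairing of the edge potential: ENGINE (M1) as a theorem -/

/-- NOT IN PRINT; OUR BOOKKEEPING.  **ENGINE E-leaf06-g46-1 (M1) AS A THEOREM, `a < b`**: in-block root `ρ = toSite r`, slot `e = (ν, y′)`, label `y`, the edge potential `m̃_ab`
(g46 `EdgePlaquettePotential`): `Σ'_u Σ_κ ((d*d)m̃_ab) κ u·(Σ'_x Σ_κ₂ (G₀∘𝒟(e)) u x (inl κ)(inl κ₂)·gaugeWt Lc y κ₂ x) = −(cE∕2)·Σ'_t Σ_l 1_{B(y)}(t+e_l)·colH G₀ Lc ν y′ l t·((d*d)m̃_ab)_l(t)` —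
§1 at the comb-free representative `m̂_ab = m̃_ab − dz μ` of §2 (bounded, periodic, comb-free, transverse), whose Maxwell image is that of `m̃_ab`. -/
theorem gaugeRead_exitPairing_edgePotential_lt {Lc : ℕ} [NeZero Lc] {r : Fin (d + 1) → ℕ} (hr : r ∈ box (d + 1) Lc) {a b : Fin (d + 1)} (hab : a < b)
    (cE cVH cΛ : ℝ) (ν : Fin (d + 1)) (y' y : Site (d + 1)) :
    ∑' u, ∑ κ, curvAdj (curv (fun β z => ((Lc : ℝ) ^ 2)⁻¹ * ((((z + unitVec β) b % (Lc : ℤ) : ℤ)) : ℝ) * dz (fun w : Site (d + 1) => ((w a : ℤ) : ℝ)) β z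
          - (Lc : ℝ)⁻¹ * (((z a % (Lc : ℤ) : ℤ)) : ℝ) * dz (fun w : Site (d + 1) => (((w b / (Lc : ℤ) : ℤ)) : ℝ)) β z)) κ u
        * (∑' x, ∑ κ₂, comp (coDressKBmAt (toSite r) Lc (KInvStep (d := d) Lc 0))
          (dM (coDressKBmAt (toSite r) Lc (KInvStep (d := d) Lc 0)) Lc (SpureRecAt d Lc (toSite r) cE cVH cΛ 0) (M1At d Lc (toSite r) cΛ 0) ν y')
          u x (Sum.inl κ) (Sum.inl κ₂) * gaugeWt Lc y κ₂ x)
      = -(cE / 2) * (∑' t, ∑ l, (if blk Lc (t + unitVec l) = y then (1 : ℝ) else 0)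
            * colH (coDressKBmAt (toSite r) Lc (KInvStep (d := d) Lc 0)) Lc ν y' l t
            * curvAdj (curv (fun β z => ((Lc : ℝ) ^ 2)⁻¹ * ((((z + unitVec β) b % (Lc : ℤ) : ℤ)) : ℝ) * dz (fun w : Site (d + 1) => ((w a : ℤ) : ℝ)) β z
                - (Lc : ℝ)⁻¹ * (((z a % (Lc : ℤ) : ℤ)) : ℝ) * dz (fun w : Site (d + 1) => (((w b / (Lc : ℤ) : ℤ)) : ℝ)) β z)) l t) := by
  have hLc : 1 ≤ Lc := one_le_of_neZero Lc
  have hD := curvAdj_curv_sub_dz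
    (fun β z => ((Lc : ℝ) ^ 2)⁻¹ * ((((z + unitVec β) b % (Lc : ℤ) : ℤ)) : ℝ) * dz (fun w : Site (d + 1) => ((w a : ℤ) : ℝ)) β z
      - (Lc : ℝ)⁻¹ * (((z a % (Lc : ℤ) : ℤ)) : ℝ) * dz (fun w : Site (d + 1) => (((w b / (Lc : ℤ) : ℤ)) : ℝ)) β z)
    (fun z : Site (d + 1) => ((Lc : ℝ) ^ 2)⁻¹ * (((z b % (Lc : ℤ) : ℤ)) : ℝ) * ((((z a % (Lc : ℤ) : ℤ)) : ℝ) - (r a : ℝ)))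
  have key := gaugeRead_exitPairing_of_transverse hr cE cVH cΛ ν y' y
    (m := fun β z => (((Lc : ℝ) ^ 2)⁻¹ * ((((z + unitVec β) b % (Lc : ℤ) : ℤ)) : ℝ) * dz (fun w : Site (d + 1) => ((w a : ℤ) : ℝ)) β z
        - (Lc : ℝ)⁻¹ * (((z a % (Lc : ℤ) : ℤ)) : ℝ) * dz (fun w : Site (d + 1) => (((w b / (Lc : ℤ) : ℤ)) : ℝ)) β z)
      - dz (fun w : Site (d + 1) => ((Lc : ℝ) ^ 2)⁻¹ * (((w b % (Lc : ℤ) : ℤ)) : ℝ) * ((((w a % (Lc : ℤ) : ℤ)) : ℝ) - (r a : ℝ))) β z)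
    (B := 2) (fun κ u => abs_combFreeEdgePotential_le hLc hr hab.ne κ u) (fun κ x v => combFreeEdgePotential_add_zsmul hLc r hab.ne κ x v)
    (fun κ u h => combFreeEdgePotential_comb_zero hLc hr hab h) (fun κ => combFreeEdgePotential_transverse hLc r hab.ne κ)
  rw [hD] at key
  exact key

/-- [folklore] `curvAdj` is odd. -/
theorem curvAdj_neg_apply (F : Form2 (d + 1) ℝ) (μ : Fin (d + 1)) (y : Site (d + 1)) :
    curvAdj (fun κ l x => -F κ l x) μ y = -curvAdj F μ y := by
  simp only [AffineAveraging.curvAdj, neg_add, ← Finset.sum_neg_distrib, neg_sub]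
  refine congrArg₂ (· + ·) (Finset.sum_congr rfl fun l _ => by ring) (Finset.sum_congr rfl fun κ _ => by ring)

/-- NOT IN PRINT; OUR BOOKKEEPING.  **THE MAXWELL IMAGE OF THE EDGE POTENTIAL IS ODD UNDER `a ↔ b`**: `(d*d)m̃_ab = −(d*d)m̃_ba` (g46 `curvAdj_curv_edgePotential`: both are the co-derivative of
`±E_ab·𝟙^{exit}_a𝟙^{exit}_b`). -/
theorem curvAdj_curv_edgePotential_swap {Lc : ℕ} (hLc : 1 ≤ Lc) {a b : Fin (d + 1)} (hab : a ≠ b) (μ : Fin (d + 1)) (y : Site (d + 1)) :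
    curvAdj (curv (fun β z => ((Lc : ℝ) ^ 2)⁻¹ * ((((z + unitVec β) b % (Lc : ℤ) : ℤ)) : ℝ) * dz (fun w : Site (d + 1) => ((w a : ℤ) : ℝ)) β z
        - (Lc : ℝ)⁻¹ * (((z a % (Lc : ℤ) : ℤ)) : ℝ) * dz (fun w : Site (d + 1) => (((w b / (Lc : ℤ) : ℤ)) : ℝ)) β z)) μ y
      = -curvAdj (curv (fun β z => ((Lc : ℝ) ^ 2)⁻¹ * ((((z + unitVec β) a % (Lc : ℤ) : ℤ)) : ℝ) * dz (fun w : Site (d + 1) => ((w b : ℤ) : ℝ)) β z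
        - (Lc : ℝ)⁻¹ * (((z b % (Lc : ℤ) : ℤ)) : ℝ) * dz (fun w : Site (d + 1) => (((w a / (Lc : ℤ) : ℤ)) : ℝ)) β z)) μ y := by
  rw [curvAdj_curv_edgePotential hLc hab, curvAdj_curv_edgePotential hLc hab.symm, ← curvAdj_neg_apply]
  congr 1
  funext κ l x
  ring

/-- NOT IN PRINT; OUR BOOKKEEPING.  **ENGINE (M1) AS A THEOREM, EVERY `a ≠ b`** (the case `b < a` by the oddness of the Maxwell image under `a ↔ b`; both sides are linear in it). -/
theorem gaugeRead_exitPairing_edgePotential {Lc : ℕ} [NeZero Lc] {r : Fin (d + 1) → ℕ} (hr : r ∈ box (d + 1) Lc) {a b : Fin (d + 1)} (hab : a ≠ b)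
    (cE cVH cΛ : ℝ) (ν : Fin (d + 1)) (y' y : Site (d + 1)) :
    ∑' u, ∑ κ, curvAdj (curv (fun β z => ((Lc : ℝ) ^ 2)⁻¹ * ((((z + unitVec β) b % (Lc : ℤ) : ℤ)) : ℝ) * dz (fun w : Site (d + 1) => ((w a : ℤ) : ℝ)) β z
          - (Lc : ℝ)⁻¹ * (((z a % (Lc : ℤ) : ℤ)) : ℝ) * dz (fun w : Site (d + 1) => (((w b / (Lc : ℤ) : ℤ)) : ℝ)) β z)) κ u
        * (∑' x, ∑ κ₂, comp (coDressKBmAt (toSite r) Lc (KInvStep (d := d) Lc 0))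
          (dM (coDressKBmAt (toSite r) Lc (KInvStep (d := d) Lc 0)) Lc (SpureRecAt d Lc (toSite r) cE cVH cΛ 0) (M1At d Lc (toSite r) cΛ 0) ν y')
          u x (Sum.inl κ) (Sum.inl κ₂) * gaugeWt Lc y κ₂ x)
      = -(cE / 2) * (∑' t, ∑ l, (if blk Lc (t + unitVec l) = y then (1 : ℝ) else 0)
            * colH (coDressKBmAt (toSite r) Lc (KInvStep (d := d) Lc 0)) Lc ν y' l t
            * curvAdj (curv (fun β z => ((Lc : ℝ) ^ 2)⁻¹ * ((((z + unitVec β) b % (Lc : ℤ) : ℤ)) : ℝ) * dz (fun w : Site (d + 1) => ((w a : ℤ) : ℝ)) β z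
                - (Lc : ℝ)⁻¹ * (((z a % (Lc : ℤ) : ℤ)) : ℝ) * dz (fun w : Site (d + 1) => (((w b / (Lc : ℤ) : ℤ)) : ℝ)) β z)) l t) := by
  have hLc : 1 ≤ Lc := one_le_of_neZero Lc
  rcases lt_or_gt_of_ne hab with h | h
  · exact gaugeRead_exitPairing_edgePotential_lt hr h cE cVH cΛ ν y' y
  · have key := gaugeRead_exitPairing_edgePotential_lt hr h cE cVH cΛ ν y' y
    simp only [curvAdj_curv_edgePotential_swap hLc hab, neg_mul, Finset.sum_neg_distrib, tsum_neg, mul_neg]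
    rw [key]
    ring

end Summit.QuantumFields.BalabanUV.Beta.GAN24.EdgePotentialAxialGauge

end
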